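import Summits.ResolutionOfSingularities.ResolutionOfSingularities.Theorems.SemivaluationShadows.Negative.FalseWithoutRational

/-!
# `SemivaluationShadows` (crux stmt-ResolutionOfSingularities-16757, route `AbhyankarShadows`):
# the hypothesis "`R` finitely generated" is load-bearing

Negative-side load-bearing analysis (cdisprove seat refuter-cdisprove-stmt-ResolutionOfSingularities-16757-0,
2026-08-17), everything PROVED, no definition introduced (`(RatFunc.inftyValuation k).valuationSubring` is LOCAL NOTATION for
`(RatFunc.inftyValuation k).valuationSubring`, the valuation ring at infinity of `k(X)`; the
hypothesis-deleted variant of the crux is stated INLINE):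

* `semivaluationShadows_false_without_Rfg` — delete `R.FG`: FALSE, witness `k = 𝔽̄₂`, `K = k(X)`,
  `O = 𝒪∞` (rational over `k`: `f ≡` ratio of leading coefficients `mod 𝔪_∞`), `R = 𝒪∞` itself
  (as a `k`-subalgebra), `F = ∅`: a shadow sandwiches a finitely generated `R₁` between `R` and `O`,
  so `R₁ = 𝒪∞` would be a f.g. `k`-algebra; but f.g. `k`-domains are Jacobson (`(0) = ⋂ 𝔪`) while
  every maximal ideal of `𝒪∞` is `𝔪_∞ ∋ 1/X ≠ 0`.

Moral for provers: `R.FG` (like `R ≤ O`) is used only through the sandwich `R ≤ R₁ ≤ O` with `R₁`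
finitely generated — junk-level, but it pins the typing.  Does NOT refute the crux.
-/

noncomputable section

set_option linter.dupNamespace false

namespace Summit.ResolutionOfSingularities.ResolutionOfSingularities.Theorems.SemivaluationShadows.Negative

/-! ### `R` finitely generated is load-bearing (witness `O = 𝒪∞ ⊆ k(X)`, `R = 𝒪∞`) -/

section
open scoped Polynomial
variable (k : Type) [Field k] [DecidableEq (RatFunc k)]


/-- Membership in `𝒪∞`. [folklore] -/
theorem mem_Oinf_iff (x : RatFunc k) : x ∈ (RatFunc.inftyValuation k).valuationSubring ↔ RatFunc.inftyValuation k x ≤ 1 :=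
  Valuation.mem_valuationSubring_iff _ _

/-- `< 1` for the abstract valuation of `𝒪∞` vs `inftyValuation`. [folklore] -/
theorem Oinf_lt_one_iff (x : RatFunc k) :
    (RatFunc.inftyValuation k).valuationSubring.valuation x < 1 ↔ RatFunc.inftyValuation k x < 1 :=
  ((Valuation.isEquiv_valuation_valuationSubring _).lt_one_iff_lt_one).symm

/-- Constants lie in `𝒪∞`. [folklore] -/
theorem C_mem_Oinf (c : k) : algebraMap k (RatFunc k) c ∈ (RatFunc.inftyValuation k).valuationSubring := by
  rw [mem_Oinf_iff, RatFunc.algebraMap_eq_C]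
  rcases eq_or_ne c 0 with rfl | hc
  · simp
  · exact (RatFunc.inftyValuation.C k hc).le

/-- `v_∞(1/X) < 1`. [folklore] -/
theorem inftyValuation_X_inv : RatFunc.inftyValuation k (RatFunc.X : RatFunc k)⁻¹ < 1 := by
  rw [map_inv₀, RatFunc.inftyValuation.X, ← WithZero.exp_neg, ← WithZero.exp_zero,
    WithZero.exp_lt_exp]
  norm_num

/-- `1/X ∈ 𝒪∞`. [folklore] -/
theorem X_inv_mem_Oinf : (RatFunc.X : RatFunc k)⁻¹ ∈ (RatFunc.inftyValuation k).valuationSubring :=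
  (mem_Oinf_iff k _).mpr (inftyValuation_X_inv k).le

/-- `1/X` lies in the maximal ideal of `𝒪∞`. [folklore] -/
theorem X_inv_lt_one : (RatFunc.inftyValuation k).valuationSubring.valuation (RatFunc.X : RatFunc k)⁻¹ < 1 :=
  (Oinf_lt_one_iff k _).mpr (inftyValuation_X_inv k)

/-- `𝒪∞` is RATIONAL over `k`: `f ≡ (ratio of leading coefficients) (mod 𝔪_∞)`. [folklore] -/
theorem Oinf_rational (x : RatFunc k) (hx : x ∈ (RatFunc.inftyValuation k).valuationSubring) :
    ∃ c : k, (RatFunc.inftyValuation k).valuationSubring.valuation (x - algebraMap k (RatFunc k) c) < 1 := by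
  simp only [Oinf_lt_one_iff, RatFunc.algebraMap_eq_C]
  rw [mem_Oinf_iff] at hx
  rcases eq_or_ne x 0 with rfl | hx0
  · exact ⟨0, by simp⟩
  rw [RatFunc.inftyValuation_apply, RatFunc.inftyValuation_of_nonzero k hx0,
    ← WithZero.exp_zero, WithZero.exp_le_exp] at hx
  rcases hx.lt_or_eq with hlt | heq
  · refine ⟨0, ?_⟩
    rw [map_zero, sub_zero, RatFunc.inftyValuation_apply, RatFunc.inftyValuation_of_nonzero k hx0,
      ← WithZero.exp_zero, WithZero.exp_lt_exp]
    exact hlt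
  · -- `deg num = deg denom`: subtract the leading-coefficient constant
    have hnd : x.num.natDegree = x.denom.natDegree := by
      simp only [RatFunc.intDegree] at heq; omega
    set c : k := x.num.leadingCoeff with hc
    have hc0 : c ≠ 0 := Polynomial.leadingCoeff_ne_zero.mpr (RatFunc.num_ne_zero hx0)
    set q : k[X] := x.num - Polynomial.C c * x.denom with hq
    have hden : algebraMap k[X] (RatFunc k) x.denom ≠ 0 :=
      RatFunc.algebraMap_ne_zero (RatFunc.denom_ne_zero x)
    have hxd : x * algebraMap k[X] (RatFunc k) x.denom = algebraMap k[X] (RatFunc k) x.num :=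
      (eq_div_iff hden).mp (RatFunc.num_div_denom x).symm
    have hxq : x - RatFunc.C c =
        algebraMap k[X] (RatFunc k) q / algebraMap k[X] (RatFunc k) x.denom := by
      rw [eq_div_iff hden, sub_mul, hq, map_sub, map_mul, RatFunc.algebraMap_C, hxd]
    refine ⟨c, ?_⟩
    rw [hxq]
    rcases eq_or_ne q 0 with hq0 | hq0
    · rw [hq0, map_zero, zero_div, map_zero]; exact zero_lt_one
    have hdeg : q.natDegree < x.denom.natDegree := by
      rw [← hnd]
      refine Polynomial.natDegree_lt_natDegree hq0 ?_
      rw [hq]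
      refine Polynomial.degree_sub_lt ?_ (RatFunc.num_ne_zero hx0) ?_
      · rw [Polynomial.degree_C_mul hc0, Polynomial.degree_eq_natDegree (RatFunc.num_ne_zero hx0),
          Polynomial.degree_eq_natDegree (RatFunc.denom_ne_zero x), hnd]
      · rw [Polynomial.leadingCoeff_mul, Polynomial.leadingCoeff_C, (RatFunc.monic_denom x).leadingCoeff,
          mul_one]
    rw [map_div₀, RatFunc.inftyValuation_apply, RatFunc.inftyValuation.polynomial k hq0,
      RatFunc.inftyValuation_apply, RatFunc.inftyValuation.polynomial k (RatFunc.denom_ne_zero x),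
      ← WithZero.exp_sub, ← WithZero.exp_zero, WithZero.exp_lt_exp]
    omega

/-- Over any field `k`: the valuation ring `𝒪∞` of `k(X)`, viewed as a `k`-subalgebra `R ≤ 𝒪∞`,
has NO shadow — a shadow would sandwich a finitely generated `R₁` between `𝒪∞` and `𝒪∞`, but a
DVR of `k(X)/k` is not a finitely generated `k`-algebra (Jacobson: `(0) = ⋂ 𝔪 = 𝔪_∞ ∋ 1/X`).
[folklore] -/
theorem no_shadow_for_Oinf
    (h : ∀ R : Subalgebra k (RatFunc k), R.toSubring ≤ (RatFunc.inftyValuation k).valuationSubring.toSubring → ∀ F : Finset R,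
      ∃ (R₁ : Subalgebra k (RatFunc k)) (hle : R ≤ R₁) (_ : R₁.toSubring ≤ (RatFunc.inftyValuation k).valuationSubring.toSubring),
        R₁.FG ∧ IsFractionRing R₁ (RatFunc k) ∧ ∃ (L : Type) (_ : Field L) (_ : Algebra k L)
        (φ : R₁ →ₐ[k] L) (O' : ValuationSubring L), Module.finrank ℤ (Additive (O'.ValueGroup)ˣ) =
          Module.finrank ℤ (Additive ((RatFunc.inftyValuation k).valuationSubring.ValueGroup)ˣ) ∧ (∀ y : R₁, φ y ∈ O') ∧
        (∀ y : R₁, O'.valuation (φ y) < 1 ↔ (RatFunc.inftyValuation k).valuationSubring.valuation (y : RatFunc k) < 1) ∧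
        (∀ z : L, z ∈ O' → ∃ c : k, O'.valuation (z - algebraMap k L c) < 1) ∧
        (MonoidHom.mrange (O'.valuation.toMonoidWithZeroHom.toMonoidHom.comp
          φ.toRingHom.toMonoidHom)).FG ∧
        ∃ ι : O'.ValueGroup →*₀o (RatFunc.inftyValuation k).valuationSubring.ValueGroup, Function.Injective ι ∧
          (∀ y : R₁, φ y ≠ 0 → ∃ y' : R₁, ι (O'.valuation (φ y)) = (RatFunc.inftyValuation k).valuationSubring.valuation (y' : RatFunc k)) ∧
          ∀ x ∈ F, ι (O'.valuation (φ (Subalgebra.inclusion hle x))) =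
            (RatFunc.inftyValuation k).valuationSubring.valuation ((x : R) : RatFunc k)) : False := by
  let RO : Subalgebra k (RatFunc k) :=
    { (RatFunc.inftyValuation k).valuationSubring.toSubring with algebraMap_mem' := fun c => C_mem_Oinf k c }
  obtain ⟨R₁, hle, h₁O, hfg1, -, -⟩ := h RO (fun x hx => hx) ∅
  have hmem : ∀ x : RatFunc k, x ∈ R₁ ↔ x ∈ (RatFunc.inftyValuation k).valuationSubring :=
    fun x => ⟨fun hx => h₁O hx, fun hx => hle (show x ∈ RO from hx)⟩
  haveI : Algebra.FiniteType k R₁ := (Subalgebra.fg_iff_finiteType _).mp hfg1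
  haveI : IsJacobsonRing R₁ := isJacobsonRing_of_finiteType (A := k)
  -- the centre `P = {y ∈ R₁ : ν y < 1}`
  let P : Ideal R₁ :=
    { carrier := {y | (RatFunc.inftyValuation k).valuationSubring.valuation (y : RatFunc k) < 1}
      add_mem' := fun {a b} ha hb => by
        simp only [Set.mem_setOf_eq, Subalgebra.coe_add] at ha hb ⊢
        exact Valuation.map_add_lt _ ha hb
      zero_mem' := by simp
      smul_mem' := fun c {y} hy => by
        simp only [Set.mem_setOf_eq, smul_eq_mul, Subalgebra.coe_mul, map_mul] at hy ⊢
        calc (RatFunc.inftyValuation k).valuationSubring.valuation (c : RatFunc k) * (RatFunc.inftyValuation k).valuationSubring.valuation (y : RatFunc k) ≤ 1 * (RatFunc.inftyValuation k).valuationSubring.valuation (y : RatFunc k) :=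
              mul_le_mul_left ((RatFunc.inftyValuation k).valuationSubring.valuation_le_one ⟨c, (hmem _).mp c.2⟩) _
          _ < 1 := by rw [one_mul]; exact hy }
  have hPne : P ≠ ⊤ := by
    intro hP
    have h1 : (1 : R₁) ∈ P := hP ▸ Submodule.mem_top
    simp [P] at h1
  have hmax : ∀ M : Ideal R₁, M.IsMaximal → M = P := by
    intro M hM
    refine hM.eq_of_le hPne fun y hy => ?_
    by_contra hy1
    have hv1 : (RatFunc.inftyValuation k).valuationSubring.valuation (y : RatFunc k) = 1 :=
      le_antisymm ((RatFunc.inftyValuation k).valuationSubring.valuation_le_one ⟨y, (hmem _).mp y.2⟩) (not_lt.mp hy1)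
    have hy0 : (y : RatFunc k) ≠ 0 := by
      intro h0; rw [h0, map_zero] at hv1; exact zero_ne_one hv1
    have hyinv : (y : RatFunc k)⁻¹ ∈ R₁ :=
      (hmem _).mpr (((RatFunc.inftyValuation k).valuationSubring.valuation_le_one_iff _).mp (by rw [map_inv₀, hv1, inv_one]))
    have hunit : IsUnit y :=
      isUnit_iff_exists_inv.mpr ⟨⟨(y : RatFunc k)⁻¹, hyinv⟩, Subtype.ext (mul_inv_cancel₀ hy0)⟩
    exact hM.ne_top (M.eq_top_of_isUnit_mem hy hunit)
  -- `X⁻¹` lies in every maximal ideal, hence in `jacobson ⊥ = ⊥`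
  let y₀ : R₁ := ⟨(RatFunc.X : RatFunc k)⁻¹, (hmem _).mpr (X_inv_mem_Oinf k)⟩
  have hy₀P : y₀ ∈ P := X_inv_lt_one k
  have hjac : (⊥ : Ideal R₁).jacobson = ⊥ :=
    isJacobsonRing_iff_prime_eq.mp inferInstance ⊥ Ideal.isPrime_bot
  have hy₀jac : y₀ ∈ (⊥ : Ideal R₁).jacobson := by
    rw [Ideal.jacobson, Ideal.mem_sInf]
    rintro M ⟨-, hM⟩
    rw [hmax M hM]
    exact hy₀P
  rw [hjac, Ideal.mem_bot] at hy₀jac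
  exact inv_ne_zero RatFunc.X_ne_zero (congrArg Subtype.val hy₀jac)

/-- **`R` finitely generated is load-bearing**: the crux `AbhyankarShadows.SemivaluationShadows`
with the hypothesis `R.FG` deleted (stated inline, otherwise verbatim) is false — witness `k = 𝔽̄₂`,
`K = k(X)`, `O = 𝒪∞`, `R = 𝒪∞` (as a `k`-subalgebra), `F = ∅`. [folklore] -/
theorem semivaluationShadows_false_without_Rfg :
    ¬ (∀ p : ℕ, p.Prime → ∀ (k K : Type) [Field k] [CharP k p] [IsAlgClosed k] [Field K]
      [Algebra k K], (⊤ : IntermediateField k K).FG → ∀ O : ValuationSubring K,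
      (∀ c : k, algebraMap k K c ∈ O) →
      (∀ x : K, x ∈ O → ∃ c : k, O.valuation (x - algebraMap k K c) < 1) →
      ∀ R : Subalgebra k K, R.toSubring ≤ O.toSubring → ∀ F : Finset R,
      ∃ (R₁ : Subalgebra k K) (hle : R ≤ R₁) (_ : R₁.toSubring ≤ O.toSubring), R₁.FG ∧
        IsFractionRing R₁ K ∧ ∃ (L : Type) (_ : Field L) (_ : Algebra k L) (φ : R₁ →ₐ[k] L)
        (O' : ValuationSubring L), Module.finrank ℤ (Additive (O'.ValueGroup)ˣ) =
          Module.finrank ℤ (Additive (O.ValueGroup)ˣ) ∧ (∀ y : R₁, φ y ∈ O') ∧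
        (∀ y : R₁, O'.valuation (φ y) < 1 ↔ O.valuation (y : K) < 1) ∧
        (∀ z : L, z ∈ O' → ∃ c : k, O'.valuation (z - algebraMap k L c) < 1) ∧
        (MonoidHom.mrange (O'.valuation.toMonoidWithZeroHom.toMonoidHom.comp
          φ.toRingHom.toMonoidHom)).FG ∧
        ∃ ι : O'.ValueGroup →*₀o O.ValueGroup, Function.Injective ι ∧
          (∀ y : R₁, φ y ≠ 0 → ∃ y' : R₁, ι (O'.valuation (φ y)) = O.valuation (y' : K)) ∧
          ∀ x ∈ F, ι (O'.valuation (φ (Subalgebra.inclusion hle x))) =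
            O.valuation ((x : R) : K)) := by
  intro h
  classical
  exact no_shadow_for_Oinf (AlgebraicClosure (ZMod 2))
    (h 2 Nat.prime_two (AlgebraicClosure (ZMod 2)) (RatFunc (AlgebraicClosure (ZMod 2)))
      (intermediateField_top_fg_ratFunc _) (RatFunc.inftyValuation (AlgebraicClosure (ZMod 2))).valuationSubring (C_mem_Oinf _) (Oinf_rational _))


end

end Summit.ResolutionOfSingularities.ResolutionOfSingularities.Theorems.SemivaluationShadows.Negative

end
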